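import Literature.Geometry.Symplectic.CanonicalSpincStructure
import Literature.Geometry.GaugeTheory.SeibergWittenPerturbationNorm
import HarnessLib

/-!
# The components of the curvature equation of Taubes's `r`-family along `ω` and along `K⁻¹`

Topic `Literature/Geometry/Symplectic`; continues `CanonicalSpincStructure` (canonical `Spin^c`
structure `𝔰_J` of `(N, s, J)`; in its unitary frames the coefficient matrix of `s` is `e⁰¹ + e²³`,
`ρ⁺(s) = diag(2i, -2i)`, the trivial summand `I ∋ u₀ = (0, 1)` being the `-2i`-eigenspace).

Taubes 1994, §2 (6): with `ψ = (α, β) ∈ Γ(I ⊕ K⁻¹)` the curvature equation of the `r`-family reads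
`P₊F_A = P₊F_{A₀} + i·(|α|² - |β|² - 1)·ω - i·(α*β + αβ*) + …`, i.e. (projecting onto the line
spanned by `ω` and onto `K⁻¹ ⊂ Λ₊ ⊗ ℂ`, as in §3 Step 1, (14)–(19)) the `ω`-component of
`P₊(F_A - F_{A₀})` is the real function `|α|² - |β|² - 1` (times `r` in the scaling `ψ = √r(α u₀ + β)`
of Taubes 1995, (5.3)) and its `K⁻¹`-component is the quadratic term `ᾱβ`.

Here, for the tree's normal form `iρ⁺(F_A) = q(ψ⁺) + iρ⁺(η)` of `(SW_η)` with
`η = η₀ - (|c|²/4)·s` (any `η₀`; Taubes's is `P₊F_{A₀}`) and `ψ⁺ = (ψ₀, ψ₁)` in a unitary frame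
(`ψ₁` the component along `u₀`, i.e. Taubes's `√r α`; `ψ₀` that along `K⁻¹`, Taubes's `√r β`):

* `I_smul_plusAction_apply_one_one`, `I_smul_plusAction_apply_zero_one`: the entries of `iρ⁺(Ω)`,
  `(iρ⁺(Ω))₁₁ = Ω⁺₀` (the `ω = e⁰¹ + e²³` coefficient) and `(iρ⁺(Ω))₀₁ = iΩ⁺₁ - Ω⁺₂`;
* `sdCoeff_twoFormMatrix_symplectic`: `s⁺ = (2, 0, 0)` in every unitary frame;
* **`sdCoeff_zero_curvature_eq_of_isSolution`** (the `ω`-component):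
  `(F_A)⁺₀ - (η₀)⁺₀ = (|ψ₁|² - |ψ₀|² - |c|²)/2` — Taubes's `r(|α|² - |β|² - 1)` up to his factor `2`;
* **`offDiag_curvature_eq_of_isSolution`** (the `K⁻¹`-component):
  `(i(F_A)⁺₁ - (F_A)⁺₂) - (i(η₀)⁺₁ - (η₀)⁺₂) = ψ₀ ψ̄₁` — Taubes's `αβ*` term, with no `r` in it.

PROVED, 0 named facts.

## References

* C. H. Taubes, *The Seiberg–Witten invariants and symplectic forms*, Math. Res. Lett. 1 (1994)
  809–822, §2 (6), §3 (14)–(19). [Taubes1994]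
* C. H. Taubes, *The Seiberg–Witten and Gromov invariants*, Math. Res. Lett. 2 (1995) 221–238,
  §5 (5.2)–(5.3). [Taubes1995]
-/

noncomputable section

open scoped Manifold ContDiff ComplexConjugate
open Set Complex Literature.Geometry.Kaehler Literature.Geometry.GaugeTheory Literature.Topology.FourManifolds
open Literature.Geometry.Lorentzian (PseudoRiemannianMetric)

namespace Literature.Geometry.Symplectic

/-! ### Entries of `iρ⁺(Ω)` -/

/-- `(iρ⁺(Ω))₁₁ = Ω⁺₀ = Ω₀₁ + Ω₂₃` (`m(i) = diag(i, -i)`, `m(j)`, `m(k)` off-diagonal). [cite: Taubes1994, §2 (6)] -/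
theorem I_smul_plusAction_apply_one_one (Ω : Matrix (Fin 4) (Fin 4) ℝ) :
    (I • plusAction Ω) 1 1 = (sdCoeff Ω 0 : ℂ) := by
  simp [plusAction, suTwoBasis, Fin.sum_univ_three, Matrix.smul_apply]
  ring_nf
  rw [I_sq]
  ring

/-- `(iρ⁺(Ω))₀₁ = iΩ⁺₁ - Ω⁺₂`. [cite: Taubes1994, §2 (6)] -/
theorem I_smul_plusAction_apply_zero_one (Ω : Matrix (Fin 4) (Fin 4) ℝ) :
    (I • plusAction Ω) 0 1 = I * (sdCoeff Ω 1 : ℂ) - (sdCoeff Ω 2 : ℂ) := by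
  simp [plusAction, suTwoBasis, Fin.sum_univ_three, Matrix.smul_apply]
  ring_nf
  rw [I_sq]
  ring

namespace AlmostComplexStructure.IsCompatibleWith

variable {N : Type*} [TopologicalSpace N] [ChartedSpace (EuclideanSpace ℝ (Fin 4)) N]
  [IsManifold (𝓡 4) ∞ N] {J : AlmostComplexStructure (𝓡 4) ∞ N} {s : MForm (𝓡 4) N ℝ 2}
  (h : J.IsCompatibleWith s) (hs : IsSmoothForm s)
  (hnd : ∀ x (v : TangentSpace (𝓡 4) x), v ≠ 0 → ∃ w : TangentSpace (𝓡 4) x, s x ![v, w] ≠ 0)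

/-- **`s⁺ = (2, 0, 0)` in every frame of the canonical `Spin^c` structure** (`s = e⁰¹ + e²³`).
[cite: Taubes1995, §5 Step 1 (p. 233)] -/
theorem sdCoeff_twoFormMatrix_symplectic (x₀ : N) {x : N} (hx : x ∈ (h.canonicalSpincStructure hs hnd).baseSet x₀) :
    sdCoeff (twoFormMatrix s x fun k ↦ (h.canonicalSpincStructure hs hnd).frame x₀ k x) = ![2, 0, 0] := by
  rw [h.twoFormMatrix_canonicalSpincStructure hs hnd x₀ hx]
  funext k
  fin_cases k <;> simp [sdCoeff, one_add_one_eq_two]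

variable [(h.metric hs).HasLeviCivita]

/-- **The `ω`-component of the curvature equation of the `r`-family** (Taubes 1994, (6):
`P₊F_A = P₊F_{A₀} + i(|α|² - |β|² - 1)ω + …`): for a solution `(A, ψ)` of `(SW_η)`,
`η = η₀ - (|c|²/4)·s`, at `x` in the unitary frame of the chart `x₀`,
`(F_A)⁺₀(x) - (η₀)⁺₀(x) = (|ψ₁|² - |ψ₀|² - |c|²)/2`, where `ψ⁺ = (ψ₀, ψ₁)`, `ψ₁` the component along
`u₀` (Taubes's `√r α`) and `ψ₀` that along `K⁻¹` (Taubes's `√r β`); with `r = |c|²` this is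
`(r/2)(|α|² - |β|² - 1)`. [cite: Taubes1994, §2 (6)] -/
theorem sdCoeff_zero_curvature_eq_of_isSolution (η₀ : (h.canonicalSpincStructure hs hnd).Perturbation) (c : ℂ)
    {cfg : (h.canonicalSpincStructure hs hnd).Configuration}
    (hsol : SpincStructure.IsSolution (η₀ - h.symplecticPerturbation hs hnd (Complex.normSq c / 4)) cfg)
    (x₀ : N) {x : N} (hx : x ∈ (h.canonicalSpincStructure hs hnd).baseSet x₀) :
    sdCoeff ((h.canonicalSpincStructure hs hnd).curvatureMatrix cfg.conn x₀ x) 0 -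
        sdCoeff (twoFormMatrix η₀.form x fun k ↦ (h.canonicalSpincStructure hs hnd).frame x₀ k x) 0 =
      (Complex.normSq (cfg.plusSpinor x₀ x 1) - Complex.normSq (cfg.plusSpinor x₀ x 0) - Complex.normSq c) / 2 := by
  have heq := (hsol x₀ x hx).1
  have h11 := congr_fun (congr_fun heq 1) 1
  rw [Matrix.add_apply, I_smul_plusAction_apply_one_one, I_smul_plusAction_apply_one_one, spinorQuad_eq,
    SpincStructure.Perturbation.twoFormMatrix_sub, symplecticPerturbation_form, twoFormMatrix_smul',
    sdCoeff_sub', sdCoeff_smul', h.sdCoeff_twoFormMatrix_symplectic hs hnd x₀ hx] at h11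
  simp only [Matrix.of_apply, Matrix.cons_val', Matrix.cons_val_one, Matrix.cons_val_zero, Matrix.cons_val_fin_one,
    Pi.sub_apply, Pi.smul_apply, smul_eq_mul] at h11
  apply Complex.ofReal_injective
  push_cast
  rw [h11]
  push_cast
  ring

/-- **The `K⁻¹`-component of the curvature equation of the `r`-family** (Taubes 1994, (6): the term
`-i(α*β + αβ*)`): for a solution `(A, ψ)` of `(SW_η)`, `η = η₀ - (|c|²/4)·s`, at `x` in the unitary
frame of the chart `x₀`, `(i(F_A)⁺₁ - (F_A)⁺₂)(x) - (i(η₀)⁺₁ - (η₀)⁺₂)(x) = ψ₀ ψ̄₁` — the symplectic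
perturbation does not enter (it is a multiple of `ω`), and the right side is Taubes's quadratic
`αβ*`-term (`r αβ̄` in the scaling `ψ = √r(α u₀ + β)`). [cite: Taubes1994, §2 (6)] -/
theorem offDiag_curvature_eq_of_isSolution (η₀ : (h.canonicalSpincStructure hs hnd).Perturbation) (c : ℂ)
    {cfg : (h.canonicalSpincStructure hs hnd).Configuration}
    (hsol : SpincStructure.IsSolution (η₀ - h.symplecticPerturbation hs hnd (Complex.normSq c / 4)) cfg)
    (x₀ : N) {x : N} (hx : x ∈ (h.canonicalSpincStructure hs hnd).baseSet x₀) :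
    (I * (sdCoeff ((h.canonicalSpincStructure hs hnd).curvatureMatrix cfg.conn x₀ x) 1 : ℂ) -
          sdCoeff ((h.canonicalSpincStructure hs hnd).curvatureMatrix cfg.conn x₀ x) 2) -
        (I * (sdCoeff (twoFormMatrix η₀.form x fun k ↦ (h.canonicalSpincStructure hs hnd).frame x₀ k x) 1 : ℂ) -
          sdCoeff (twoFormMatrix η₀.form x fun k ↦ (h.canonicalSpincStructure hs hnd).frame x₀ k x) 2) =
      cfg.plusSpinor x₀ x 0 * conj (cfg.plusSpinor x₀ x 1) := by
  have heq := (hsol x₀ x hx).1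
  have h01 := congr_fun (congr_fun heq 0) 1
  rw [Matrix.add_apply, I_smul_plusAction_apply_zero_one, I_smul_plusAction_apply_zero_one, spinorQuad_eq,
    SpincStructure.Perturbation.twoFormMatrix_sub, symplecticPerturbation_form, twoFormMatrix_smul',
    sdCoeff_sub', sdCoeff_smul', h.sdCoeff_twoFormMatrix_symplectic hs hnd x₀ hx] at h01
  simp only [Matrix.of_apply, Matrix.cons_val', Matrix.cons_val_one, Matrix.cons_val_zero, Matrix.cons_val_fin_one,
    Pi.sub_apply, Pi.smul_apply, smul_eq_mul, mul_zero, sub_zero] at h01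
  rw [h01]
  push_cast
  ring

end AlmostComplexStructure.IsCompatibleWith

end Literature.Geometry.Symplectic

end
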